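import Mathlib.Algebra.Module.ZLattice.Basic
import Mathlib.Analysis.Normed.Module.FiniteDimension
import Literature.Geometry.ComplexAnalytic.RelativeExponentialChart
import Literature.Geometry.ComplexAnalytic.RelativeExponentialChartEtaleOfMFDeriv
import HarnessLib

/-!
# Relative exponential FLOW data with lattice kernels have HOLOMORPHIC PERIODS
# ([BirkenhakeLange2004] Ch. 8 §8.7; [DeligneHodgeII1971] §4.4 (4.4.2)–(4.4.3))

Layer `Literature/Geometry/ComplexAnalytic`, namespace `Literature.Geometry.ComplexAnalytic`.  THEOREMS ONLY (no definition, no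
named fact, no instance, no notation, no `sorry`).  Cell `hodgecm-mathlib` (D-0151), FLOOR 0, P6 «MOD» (crux hLiu418 =
stmt-HodgeConjecture-24832, `--supports`), «L8-PREP» (organ letter **(L2)** of LA1-plan (g2)'s
`RelativeExponentialFlowChart.letters.v1.lean` f624b8d3, VERBATIM; payer LA5-p01 (g2)).  HC_CM is proved only modulo the printed
citations (2 remaining named inputs hLiu418 24832, h413 24833) until rung 0 closes; this file is generic complex analysis, count-neutral.

THE SETTING is the tree's generic currency of ★ `IsRelExpChartOn EB EM p U Φ ex` (`RelativeExponentialChart.lean`): complex manifolds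
`p : M → B` (models `EM`, `EB`, finite-dimensional), a complex vector space `E`, and a RELATIVE EXPONENTIAL FLOW DATUM on an open `U ⊆ B`
unbundled into hypotheses — `ex : B × E → M` of class `C^ω` on `U × E` (`hex`), over `p` (`hp`), with bijective complex differential on
`U × E` (`hbij`) — whose fibrewise stabilisers `K(b) = {w | ex (b, w) = ex (b, 0)}`, `b ∈ U`, are FULL LATTICES `Φ₀ (ℤ^ι)` (`hlat`).

* **`exists_holomorphic_periods_of_relExpFlow`** — if `M` is Hausdorff, every `m ∈ U` has an open `V ∋ m`, `V ⊆ U`, and a PERIOD FAMILY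
  `Φ : B → ((ι → ℝ) ≃L[ℝ] E)`, holomorphic on `V` (`b ↦ Φ b x` for every `x`), with `K(v) = Φ v (ℤ^ι)` for all `v ∈ V`.

THE PROOF (the period map of a family is holomorphic, [BirkenhakeLange2004] Ch. 8 §8.7, written for abstract flow data).  Fix a
`ℤ`-basis `nᵢ = Φ₀ eᵢ` of `K(m)`.  Since `ex (m, nᵢ) = ex (m, 0)`, the holomorphic local inverse `eᵢ` of `ex` at `(m, nᵢ)` (★
`exists_localInverse_of_bijective_mfderiv`, the inverse function theorem) continues `nᵢ` to `Nᵢ(v) := (eᵢ⁻¹ (ex (v, 0))).2` for `v`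
near `m`; `hp` pins the first coordinate of `eᵢ⁻¹ (ex (v, 0))` to `v`, so `ex (v, Nᵢ(v)) = ex (v, 0)`, i.e. `Nᵢ(v) ∈ K(v)`, and
`v ↦ Nᵢ(v)` is holomorphic.  Real independence of `(Nᵢ(v))ᵢ` is an open condition, so near `m` they form a real basis of `E` and
`Φ v := (x ↦ Σ xᵢ Nᵢ(v))`; `Φ v (ℤ^ι) ⊆ K(v)` because `K(v)` is an additive subgroup (it is SOME lattice, `hlat`).  SPANNING near
`m`: otherwise there are `v → m` and `w_v ∈ K(v) ∖ Φ v (ℤ^ι)`; reducing `w_v` modulo `Φ v (ℤ^ι)` into the fundamental parallelepiped of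
`(Nᵢ(v))ᵢ` (Mathlib `ZSpan.fract`) keeps it in `K(v) ∖ Φ v (ℤ^ι)` and makes it bounded, so (finite dimension) the `w_v` cluster at some
`w`; by continuity of `ex` and the HAUSDORFF property of `M`, `ex (m, w) = ex (m, 0)`, so `w = Σ aᵢ nᵢ` with `aᵢ ∈ ℤ`; but then
`(v, w_v)` and `(v, Σ aᵢ Nᵢ(v))` are two points near `(m, w)` with the same image `ex (v, 0)`, and `ex` is injective near `(m, w)`
(local inverse again) — so `w_v = Σ aᵢ Nᵢ(v) ∈ Φ v (ℤ^ι)`, a contradiction.  (Filters replace sequences: `m` is a cluster point of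
the bad set, the reduced witnesses push forward to a filter on a compact ball.)

Junk guards: `T2Space M` is load-bearing (the spanning step); empty `U`, `E = 0`, `ι` empty are harmless (trivially true statements).

## References
* [BirkenhakeLange2004] C. Birkenhake, H. Lange, *Complex Abelian Varieties*, 2nd ed. (2004), §1.1 and Ch. 8 §8.7.
* [DeligneHodgeII1971] P. Deligne, *Théorie de Hodge II*, Publ. Math. IHÉS 40 (1971), §4.4 (4.4.2)–(4.4.3).
* [FritzscheGrauert2002] K. Fritzsche, H. Grauert, *From Holomorphic Functions to Complex Manifolds* (2002), Ch. I §7 Thm. 7.6.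
-/

set_option autoImplicit false

noncomputable section

open scoped Manifold ContDiff Topology
open Set Function Filter Metric Module

namespace Literature.Geometry.ComplexAnalytic

variable {EB : Type*} [NormedAddCommGroup EB] [NormedSpace ℂ EB] [FiniteDimensional ℂ EB]
  {B : Type*} [TopologicalSpace B] [ChartedSpace EB B]
  {E : Type*} [NormedAddCommGroup E] [NormedSpace ℂ E] [FiniteDimensional ℂ E]
  {EM : Type*} [NormedAddCommGroup EM] [NormedSpace ℂ EM]
  {M : Type*} [TopologicalSpace M] [ChartedSpace EM M]
  {ι : Type*}

omit [FiniteDimensional ℂ E] in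
/-- A set which is the image of `ℤ^ι` under a real-linear isomorphism `(ι → ℝ) ≃ E` (a lattice `Λ ⊂ V`) is (the carrier of) an
additive subgroup of `E`. [cite: BirkenhakeLange2004, §1.1 Lemma 1.1.1 (p. 8)] -/
private theorem exists_addSubgroup_of_lattice (Φ' : (ι → ℝ) ≃L[ℝ] E) {K : E → Prop}
    (hK : ∀ w, K w ↔ ∃ n : ι → ℤ, w = Φ' (fun i => (n i : ℝ))) :
    ∃ H : AddSubgroup E, ∀ w, w ∈ H ↔ K w := by
  refine ⟨(((Φ' : (ι → ℝ) ≃L[ℝ] E) : (ι → ℝ) →+ E).comp ((Int.castAddHom ℝ).compLeft ι)).range, fun w => ?_⟩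
  rw [hK, AddMonoidHom.mem_range]
  constructor
  · rintro ⟨n, rfl⟩
    exact ⟨n, rfl⟩
  · rintro ⟨n, rfl⟩
    exact ⟨n, rfl⟩

omit [FiniteDimensional ℂ EB] [FiniteDimensional ℂ E] in
/-- Finite sums of maps `B → E` holomorphic on `V` are holomorphic on `V` (Mathlib `MDifferentiableOn.add`, iterated; used for the
period family `b ↦ Σ xᵢ Nᵢ(b)`). [cite: BirkenhakeLange2004, Ch. 8 §8.7] -/
private theorem mdifferentiableOn_finset_sum {f : ι → B → E} {s : Finset ι} {V : Set B}
    (hf : ∀ i ∈ s, MDifferentiableOn 𝓘(ℂ, EB) 𝓘(ℂ, E) (f i) V) :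
    MDifferentiableOn 𝓘(ℂ, EB) 𝓘(ℂ, E) (fun b => ∑ i ∈ s, f i b) V := by
  classical
  induction s using Finset.induction_on with
  | empty => simpa using mdifferentiableOn_const
  | insert a s has ih =>
    have h1 : MDifferentiableOn 𝓘(ℂ, EB) 𝓘(ℂ, E) (f a) V := hf a (Finset.mem_insert_self a s)
    have h2 := ih fun i hi => hf i (Finset.mem_insert_of_mem hi)
    have h3 : (fun b => ∑ i ∈ insert a s, f i b) = f a + fun b => ∑ i ∈ s, f i b := by
      funext b; simp [Finset.sum_insert has]
    rw [h3]
    exact h1.add h2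

omit [FiniteDimensional ℂ E] in
/-- Images of integer vectors under a real frame: `Φ' (n ·) = Σᵢ nᵢ • Φ' eᵢ` (lattice points are the integer combinations of the
lattice basis). [cite: BirkenhakeLange2004, §1.1 Lemma 1.1.1 (p. 8)] -/
private theorem map_intVec_eq_sum [Fintype ι] [DecidableEq ι] (Φ' : (ι → ℝ) ≃L[ℝ] E) (n : ι → ℤ) :
    Φ' (fun i => (n i : ℝ)) = ∑ i, (n i : ℝ) • Φ' (Pi.single i (1 : ℝ)) := by
  have h : (fun i => (n i : ℝ)) = ∑ i, (n i : ℝ) • (Pi.single i (1 : ℝ) : ι → ℝ) := by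
    funext j
    simp only [Finset.sum_apply, Pi.smul_apply, Pi.single_apply, smul_eq_mul, mul_ite, mul_one, mul_zero,
      Finset.sum_ite_eq, Finset.mem_univ, if_true]
  rw [h, map_sum]
  simp only [map_smul]

/-- **(L2) HOLOMORPHIC PERIODS.**  For a relative exponential flow datum on `U` (`ex : B × E → M` of class `C^ω` on `U × E`, over
`p`, with bijective complex differential on `U × E`) in a HAUSDORFF total space whose fibrewise stabilisers are full lattices
(`{w | ex (b, w) = ex (b, 0)} = Φ₀ (ℤ^ι)` for every `b ∈ U`), every `m ∈ U` has an open `V`, `m ∈ V ⊆ U`, and a period family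
`Φ : B → (ℝ^ι ≃L[ℝ] E)`, holomorphic on `V` in the sense of ★ `IsRelExpChartOn` (`b ↦ Φ b x` for every `x`), with
`{w | ex (v, w) = ex (v, 0)} = Φ v (ℤ^ι)` for all `v ∈ V`.  (Continue a `ℤ`-basis of `K(m)` through the holomorphic local inverses of
`ex` (★ `exists_localInverse_of_bijective_mfderiv`); real independence is open; spanning near `m` by reduction into the fundamental
parallelepiped (`ZSpan.fract`), compactness, the Hausdorff property of `M` and local injectivity of `ex`.)
[cite: BirkenhakeLange2004, Ch. 8 §8.7] [cite: DeligneHodgeII1971, §4.4 (4.4.2)–(4.4.3)] -/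
theorem exists_holomorphic_periods_of_relExpFlow [Fintype ι] [T2Space M] [IsManifold 𝓘(ℂ, EB) ω B] [IsManifold 𝓘(ℂ, EM) ω M]
    {p : M → B} {U : Set B} {ex : B × E → M} (hU : IsOpen U)
    (hex : ContMDiffOn (𝓘(ℂ, EB).prod 𝓘(ℂ, E)) 𝓘(ℂ, EM) ω ex (U ×ˢ (univ : Set E)))
    (hp : ∀ b ∈ U, ∀ z : E, p (ex (b, z)) = b)
    (hbij : ∀ q ∈ U ×ˢ (univ : Set E), Bijective (mfderiv (𝓘(ℂ, EB).prod 𝓘(ℂ, E)) 𝓘(ℂ, EM) ex q))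
    (hlat : ∀ b ∈ U, ∃ Φ₀ : (ι → ℝ) ≃L[ℝ] E,
      ∀ w : E, ex (b, w) = ex (b, 0) ↔ ∃ n : ι → ℤ, w = Φ₀ (fun i => (n i : ℝ)))
    {m : B} (hm : m ∈ U) :
    ∃ V : Set B, IsOpen V ∧ m ∈ V ∧ V ⊆ U ∧ ∃ Φ : B → ((ι → ℝ) ≃L[ℝ] E),
      (∀ x : ι → ℝ, MDifferentiableOn 𝓘(ℂ, EB) 𝓘(ℂ, E) (fun b => Φ b x) V) ∧
      ∀ v ∈ V, ∀ w : E, ex (v, w) = ex (v, 0) ↔ ∃ n : ι → ℤ, w = Φ v (fun i => (n i : ℝ)) := by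
  classical
  have hUE : IsOpen (U ×ˢ (univ : Set E)) := hU.prod isOpen_univ
  -- continuity of `ex` on `U × E` and of `v ↦ ex (v, 0)` on `U`
  have hexc : ContinuousOn ex (U ×ˢ (univ : Set E)) := hex.continuousOn
  have hexd : MDifferentiableOn (𝓘(ℂ, EB).prod 𝓘(ℂ, E)) 𝓘(ℂ, EM) ex (U ×ˢ (univ : Set E)) :=
    hex.mdifferentiableOn (by simp)
  have hz0d : MDifferentiable 𝓘(ℂ, EB) (𝓘(ℂ, EB).prod 𝓘(ℂ, E)) (fun v : B => (v, (0 : E))) :=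
    mdifferentiable_id.prodMk mdifferentiable_const
  have hz0c : Continuous (fun v : B => (v, (0 : E))) := hz0d.continuous
  have hex0c : ContinuousOn (fun v : B => ex (v, 0)) U :=
    hexc.comp hz0c.continuousOn fun v hv => ⟨hv, mem_univ _⟩
  -- the étale field: holomorphic local inverses of `ex` at every point of `U × E`
  have hloc := exists_localInverse_of_bijective_mfderiv (n := ω) (by simp) hU hex hbij
  -- the lattice at `m` and its `ℤ`-basis `n i`
  obtain ⟨Φ₀, hΦ₀⟩ := hlat m hm
  have hcard : Fintype.card ι = Module.finrank ℝ E := by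
    rw [← Φ₀.toLinearEquiv.finrank_eq, Module.finrank_fintype_fun_eq_card]
  set n : ι → E := fun i => Φ₀ (Pi.single i (1 : ℝ)) with hn_def
  have hnK : ∀ i, ex (m, n i) = ex (m, 0) := by
    intro i
    refine (hΦ₀ (n i)).2 ⟨Pi.single i 1, ?_⟩
    show Φ₀ (Pi.single i (1 : ℝ)) = Φ₀ _
    congr 1
    funext j
    simp only [Pi.single_apply, Int.cast_ite, Int.cast_one, Int.cast_zero]
  have hnli : LinearIndependent ℝ n := by
    have : n = ⇑((Pi.basisFun ℝ ι).map Φ₀.toLinearEquiv) := by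
      funext i
      simp [hn_def, Basis.map_apply, Pi.basisFun_apply]
    rw [this]
    exact Basis.linearIndependent _
  -- local inverses `e i` of `ex` at the lattice points `(m, n i)`
  have he : ∀ i, ∃ e : OpenPartialHomeomorph (B × E) M, (m, n i) ∈ e.source ∧ e.source ⊆ U ×ˢ univ ∧
      (∀ y ∈ e.source, e y = ex y) ∧ MDifferentiableOn 𝓘(ℂ, EM) (𝓘(ℂ, EB).prod 𝓘(ℂ, E)) e.symm e.target :=
    fun i => hloc (m, n i) ⟨hm, mem_univ _⟩
  choose e hme hesrc heex hesymm using he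
  -- the continued lattice vectors `N i v := (e i)⁻¹ (ex (v, 0))).2` on `V₀ := {v ∈ U | ex (v, 0) ∈ ⋂ (e i).target}`
  set N : ι → B → E := fun i v => ((e i).symm (ex (v, 0))).2 with hN_def
  set V₀ : Set B := U ∩ (fun v : B => ex (v, 0)) ⁻¹' (⋂ i, (e i).target) with hV₀_def
  have hV₀o : IsOpen V₀ :=
    hex0c.isOpen_inter_preimage hU (isOpen_iInter_of_finite fun i => (e i).open_target)
  have hV₀U : V₀ ⊆ U := inter_subset_left
  have hmV₀ : m ∈ V₀ := by
    refine ⟨hm, mem_iInter.2 fun i => ?_⟩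
    show ex (m, 0) ∈ (e i).target
    rw [← hnK i, ← heex i _ (hme i)]
    exact (e i).map_source (hme i)
  -- for `v ∈ V₀`: `(e i)⁻¹ (ex (v, 0)) = (v, N i v)` lies in the source, and `ex (v, N i v) = ex (v, 0)`
  have hsymm_mem : ∀ i, ∀ v ∈ V₀, (e i).symm (ex (v, 0)) ∈ (e i).source :=
    fun i v hv => (e i).map_target (mem_iInter.1 hv.2 i)
  have hsymm_eq : ∀ i, ∀ v ∈ V₀, (e i).symm (ex (v, 0)) = (v, N i v) := by
    intro i v hv
    have hq := hsymm_mem i v hv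
    have hqU : ((e i).symm (ex (v, 0))).1 ∈ U := (hesrc i hq).1
    have hexq : ex ((e i).symm (ex (v, 0))) = ex (v, 0) := by
      rw [← heex i _ hq]
      exact (e i).right_inv (mem_iInter.1 hv.2 i)
    have h1 : ((e i).symm (ex (v, 0))).1 = v := by
      have := hp _ hqU ((e i).symm (ex (v, 0))).2
      rw [Prod.mk.eta, hexq, hp v (hV₀U hv) 0] at this
      exact this.symm
    exact Prod.ext h1 rfl
  have hNK : ∀ i, ∀ v ∈ V₀, ex (v, N i v) = ex (v, 0) := by
    intro i v hv
    have hq := hsymm_mem i v hv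
    rw [hsymm_eq i v hv] at hq
    rw [← heex i _ hq, ← hsymm_eq i v hv]
    exact (e i).right_inv (mem_iInter.1 hv.2 i)
  have hNm : ∀ i, N i m = n i := by
    intro i
    have h := hsymm_eq i m hmV₀
    rw [← hnK i, ← heex i _ (hme i), (e i).left_inv (hme i)] at h
    exact (Prod.ext_iff.1 h).2.symm
  -- `N i` is holomorphic, hence continuous, on `V₀`
  have hNd : ∀ i, MDifferentiableOn 𝓘(ℂ, EB) 𝓘(ℂ, E) (N i) V₀ := by
    intro i
    have h1 : MDifferentiableOn 𝓘(ℂ, EB) 𝓘(ℂ, EM) (fun v : B => ex (v, 0)) V₀ :=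
      (hexd.comp hz0d.mdifferentiableOn fun v hv => ⟨hv, mem_univ _⟩).mono hV₀U
    have h2 : MDifferentiableOn 𝓘(ℂ, EB) (𝓘(ℂ, EB).prod 𝓘(ℂ, E)) (fun v : B => (e i).symm (ex (v, 0))) V₀ :=
      (hesymm i).comp h1 fun v hv => mem_iInter.1 hv.2 i
    exact mdifferentiable_snd.comp_mdifferentiableOn h2
  have hNc : ∀ i, ContinuousOn (N i) V₀ := fun i => (hNd i).continuousOn
  -- the open set `V₁ ⊆ V₀` where `(N i v)ᵢ` is a real basis of `E`
  set V₁ : Set B := V₀ ∩ (fun v : B => fun i => N i v) ⁻¹' {f : ι → E | LinearIndependent ℝ f} with hV₁_def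
  have hV₁o : IsOpen V₁ :=
    (continuousOn_pi.2 hNc).isOpen_inter_preimage hV₀o isOpen_setOf_linearIndependent
  have hmV₁ : m ∈ V₁ := by
    refine ⟨hmV₀, ?_⟩
    show LinearIndependent ℝ fun i => N i m
    simp_rw [hNm]
    exact hnli
  have hV₁U : V₁ ⊆ U := fun v hv => hV₀U hv.1
  -- the period family
  let bOf : ∀ v : B, LinearIndependent ℝ (fun i => N i v) → Basis ι ℝ E :=
    fun v h => basisOfLinearIndependentOfCardEqFinrank' (fun i => N i v) h hcard
  have hbOf : ∀ v h, ⇑(bOf v h) = fun i => N i v := fun v h => coe_basisOfLinearIndependentOfCardEqFinrank' _ _ _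
  let Φ : B → ((ι → ℝ) ≃L[ℝ] E) := fun v =>
    if h : LinearIndependent ℝ (fun i => N i v) then ((bOf v h).equivFun.symm).toContinuousLinearEquiv else Φ₀
  have hΦapply : ∀ v, LinearIndependent ℝ (fun i => N i v) → ∀ x : ι → ℝ, Φ v x = ∑ i, x i • N i v := by
    intro v h x
    simp only [Φ, dif_pos h]
    rw [LinearEquiv.coe_toContinuousLinearEquiv', Basis.equivFun_symm_apply, hbOf]
  -- `Φ v (ℤ^ι) ⊆ K(v)` on `V₁`: `K(v)` is an additive subgroup containing the `N i v`
  have hΦK : ∀ v ∈ V₁, ∀ a : ι → ℤ, ex (v, Φ v (fun i => (a i : ℝ))) = ex (v, 0) := by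
    intro v hv a
    obtain ⟨Φv, hΦv⟩ := hlat v (hV₁U hv)
    obtain ⟨H, hH⟩ := exists_addSubgroup_of_lattice Φv hΦv
    rw [hΦapply v hv.2]
    refine (hH _).1 (H.sum_mem fun i _ => ?_)
    rw [Int.cast_smul_eq_zsmul ℝ]
    exact H.zsmul_mem ((hH _).2 (hNK i v hv.1)) _
  -- the bad set: points of `V₁` whose stabiliser is strictly bigger than `Φ v (ℤ^ι)`
  set bad : Set B := {v | v ∈ V₁ ∧ ∃ w : E, ex (v, w) = ex (v, 0) ∧ ∀ a : ι → ℤ, w ≠ Φ v (fun i => (a i : ℝ))}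
    with hbad_def
  by_cases hcl : ClusterPt m (𝓟 bad)
  · -- the spanning argument: a cluster point of the bad set is impossible
    exfalso
    -- reduced witnesses
    have hW : ∀ v ∈ bad, ∃ w' : E, ex (v, w') = ex (v, 0) ∧ (∀ a : ι → ℤ, w' ≠ Φ v (fun i => (a i : ℝ))) ∧
        ‖w'‖ ≤ ∑ i, ‖N i v‖ := by
      rintro v ⟨hv1, w, hwK, hwa⟩
      have hli : LinearIndependent ℝ (fun i => N i v) := hv1.2
      obtain ⟨Φv, hΦv⟩ := hlat v (hV₁U hv1)
      obtain ⟨H, hH⟩ := exists_addSubgroup_of_lattice Φv hΦv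
      -- the integer part of `w` in the basis `N · v`
      have hfl : (ZSpan.floor (bOf v hli) w : E) ∈ Submodule.span ℤ (Set.range (bOf v hli)) :=
        (ZSpan.floor (bOf v hli) w).2
      obtain ⟨c, hc⟩ := (Submodule.mem_span_range_iff_exists_fun ℤ).1 hfl
      have hc' : (ZSpan.floor (bOf v hli) w : E) = Φ v (fun i => (c i : ℝ)) := by
        rw [hΦapply v hli, ← hc]
        refine Finset.sum_congr rfl fun i _ => ?_
        simp only [hbOf, Int.cast_smul_eq_zsmul ℝ]
      refine ⟨ZSpan.fract (bOf v hli) w, ?_, ?_, ?_⟩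
      · -- still in `K(v)`
        rw [ZSpan.fract_apply, hc']
        exact (hH _).1 (H.sub_mem ((hH _).2 hwK) ((hH _).2 (hΦK v hv1 c)))
      · -- still not in `Φ v (ℤ^ι)`
        intro a ha
        apply hwa (a + c)
        rw [ZSpan.fract_apply, hc', sub_eq_iff_eq_add] at ha
        rw [ha, ← map_add]
        congr 1
        funext i
        simp only [Pi.add_apply, Int.cast_add]
      · -- bounded by the size of the basis
        have := ZSpan.norm_fract_le (bOf v hli) w
        simpa only [hbOf] using this
    choose! W hWK hWa hWle using hW
    -- the witnesses are eventually in a fixed compact ball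
    have hNcm : ∀ i, ContinuousAt (N i) m := fun i => (hNc i).continuousAt (hV₀o.mem_nhds hmV₀)
    have hT : ∀ᶠ v in 𝓝 m, ∀ i, ‖N i v‖ < ‖n i‖ + 1 := by
      refine eventually_all.2 fun i => ?_
      have h := (hNcm i).norm
      have hlt : ‖N i m‖ < ‖n i‖ + 1 := by rw [hNm i]; exact lt_add_one _
      exact Filter.Tendsto.eventually_lt_const hlt h
    set R : ℝ := ∑ i, (‖n i‖ + 1) with hR_def
    set G : Filter B := 𝓝 m ⊓ 𝓟 bad with hG_def
    have hGne : G.NeBot := hcl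
    have hGbad : ∀ᶠ v in G, v ∈ bad := mem_inf_of_right (mem_principal_self bad)
    have hGball : ∀ᶠ v in G, W v ∈ closedBall (0 : E) R := by
      filter_upwards [hT.filter_mono inf_le_left, hGbad] with v hv hvb
      rw [mem_closedBall_zero_iff]
      exact (hWle v hvb).trans (Finset.sum_le_sum fun i _ => (hv i).le)
    haveI : (map W G).NeBot := hGne.map W
    obtain ⟨w, -, hclus⟩ := (isCompact_closedBall (0 : E) R) (f := map W G) (le_principal_iff.2 hGball)
    -- extraction: near `m` and near `w` there are bad points with their reduced witnesses
    have extract : ∀ A ∈ 𝓝 m, ∀ S ∈ 𝓝 w, ∃ v ∈ A, v ∈ bad ∧ W v ∈ S := by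
      intro A hA S hS
      have hAG : A ∩ bad ∈ G := inter_mem_inf hA (mem_principal_self _)
      obtain ⟨y, hyS, ⟨v, ⟨hvA, hvbad⟩, rfl⟩⟩ := clusterPt_iff_nonempty.1 hclus hS (image_mem_map hAG)
      exact ⟨v, hvA, hvbad, hyS⟩
    -- (1) `w ∈ K(m)` by continuity of `ex` and the Hausdorff property of `M`
    have hwK : ex (m, w) = ex (m, 0) := by
      by_contra hne
      obtain ⟨O₁, O₂, hO₁, hO₂, h₁, h₂, hdisj⟩ := t2_separation hne
      have hc1 : ContinuousAt ex (m, w) := hexc.continuousAt (hUE.mem_nhds ⟨hm, mem_univ _⟩)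
      have hpre : ex ⁻¹' O₁ ∈ 𝓝 (m, w) := hc1.preimage_mem_nhds (hO₁.mem_nhds h₁)
      obtain ⟨A₁, hA₁, S₁, hS₁, hAS⟩ := mem_nhds_prod_iff.1 hpre
      have hc2 : ContinuousAt (fun v : B => ex (v, 0)) m := hex0c.continuousAt (hU.mem_nhds hm)
      have hA₂ : (fun v : B => ex (v, 0)) ⁻¹' O₂ ∈ 𝓝 m := hc2.preimage_mem_nhds (hO₂.mem_nhds h₂)
      obtain ⟨v, ⟨hvA₁, hvA₂⟩, hvbad, hvS⟩ := extract _ (inter_mem hA₁ hA₂) S₁ hS₁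
      have hin₁ : ex (v, W v) ∈ O₁ := hAS (mk_mem_prod hvA₁ hvS)
      have hin₂ : ex (v, W v) ∈ O₂ := by
        rw [hWK v hvbad]
        exact hvA₂
      exact (Set.disjoint_left.1 hdisj) hin₁ hin₂
    obtain ⟨a, ha⟩ := (hΦ₀ w).1 hwK
    -- so `w = Σ aᵢ nᵢ`, and `g v := Φ v a = Σ aᵢ N i v` is continuous at `m` with `g m = w`
    have hwsum : w = ∑ i, (a i : ℝ) • n i := by
      rw [ha]
      exact map_intVec_eq_sum Φ₀ a
    set g : B → E := fun v => ∑ i, (a i : ℝ) • N i v with hg_def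
    have hgc : ContinuousAt g m := by
      have : ContinuousOn g V₀ := continuousOn_finsetSum _ fun i _ => (hNc i).const_smul _
      exact this.continuousAt (hV₀o.mem_nhds hmV₀)
    have hgm : g m = w := by
      rw [hwsum]
      simp only [hg_def, hNm]
    have hgΦ : ∀ v ∈ V₁, g v = Φ v (fun i => (a i : ℝ)) := fun v hv => (hΦapply v hv.2 _).symm
    -- (2) local injectivity of `ex` at `(m, w)`
    obtain ⟨e₀, hme₀, -, he₀ex, -⟩ := hloc (m, w) ⟨hm, mem_univ _⟩
    have hsrc : e₀.source ∈ 𝓝 (m, w) := e₀.open_source.mem_nhds hme₀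
    obtain ⟨A₃, hA₃, S₃, hS₃, hAS₃⟩ := mem_nhds_prod_iff.1 hsrc
    have hA₄ : g ⁻¹' S₃ ∈ 𝓝 m := hgc.preimage_mem_nhds (by rw [hgm]; exact hS₃)
    obtain ⟨v, ⟨hvA₃, hvA₄⟩, hvbad, hvS⟩ := extract _ (inter_mem hA₃ hA₄) S₃ hS₃
    have hv1 : v ∈ V₁ := hvbad.1
    have hq₁ : (v, W v) ∈ e₀.source := hAS₃ (mk_mem_prod hvA₃ hvS)
    have hq₂ : (v, g v) ∈ e₀.source := hAS₃ (mk_mem_prod hvA₃ hvA₄)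
    have himg : e₀ (v, W v) = e₀ (v, g v) := by
      rw [he₀ex _ hq₁, he₀ex _ hq₂, hWK v hvbad, hgΦ v hv1, hΦK v hv1 a]
    have hWg : W v = g v := (Prod.ext_iff.1 (e₀.injOn hq₁ hq₂ himg)).2
    exact hWa v hvbad a (hWg.trans (hgΦ v hv1))
  · -- no bad points near `m`: the period family works on `V := V₁ ∩ interior badᶜ`
    have hint : m ∈ interior badᶜ := by
      rw [← mem_closure_iff_clusterPt] at hcl
      rwa [interior_compl]
    refine ⟨V₁ ∩ interior badᶜ, hV₁o.inter isOpen_interior, ⟨hmV₁, hint⟩,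
      fun v hv => hV₁U hv.1, Φ, fun x => ?_, fun v hv w => ?_⟩
    · -- holomorphy of `b ↦ Φ b x` on `V`
      have hsub : V₁ ∩ interior badᶜ ⊆ V₀ := fun v hv => hv.1.1
      have h1 : MDifferentiableOn 𝓘(ℂ, EB) 𝓘(ℂ, E) (fun b => ∑ i, ((x i : ℂ) • N i b)) (V₁ ∩ interior badᶜ) :=
        mdifferentiableOn_finset_sum fun i _ => ((hNd i).mono hsub).const_smul (x i : ℂ)
      refine h1.congr fun b hb => ?_
      rw [hΦapply b hb.1.2]
      refine Finset.sum_congr rfl fun i _ => ?_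
      exact (Complex.coe_smul (x i) (N i b)).symm
    · constructor
      · intro hwK
        have hnb : v ∉ bad := fun h => interior_subset hv.2 h
        by_contra hcon
        exact hnb ⟨hv.1, w, hwK, fun a ha => hcon ⟨a, ha⟩⟩
      · rintro ⟨a, rfl⟩
        exact hΦK v hv.1 a

end Literature.Geometry.ComplexAnalytic

end
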